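import Literature.NumberTheory.DiophantineGeometry.FirstRowPeeling
import Literature.RepresentationTheory.FiniteGroups.SymmetricGroupCharacterDegreeCoeff
import Literature.RepresentationTheory.FiniteGroups.VershikKerovMaxDegreeProofs
import HarnessLib

/-!
# The one-column shape: `f^{(1,…,1)} = 1`, `Σ_{μ ⊢ N+1, ℓ(μ) ≤ N} (f^μ)² = (N+1)! − 1`, and the pairing `Σ_d [x^d](a_ρ p_1^N)·[x^d] a_{ρ+1} = N!`

HONEST FRAMING: exact (Metropolis-corrected) sampling algorithms for lattice gauge theory;
figures of merit are autocorrelation/cost numbers at stated couplings and volumes; no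
continuum-physics claim.

Venture `LatticeQCDFlow` (cell pub-lqcd), sub-topic `Scoring`; FANOUT row 5 (`s0-sun-a`), GEN-23.
NEW WORK of the cell (placement rule).  The combinatorial input for THE FIRST NON-GAUSSIAN TRACE MOMENT of a
Haar unitary (`UNHaarTraceMomentsTableaux`: `∫_{U(N)} |tr U|^{2n} dU = Σ_{μ ⊢ n, ℓ(μ) ≤ N} (f^μ)²`, `= n!` for
`n ≤ N`): at `n = N + 1` exactly one partition is excluded, the column `(1, …, 1)`, and it has one standard
Young tableau, so `∫_{U(N)} |tr U|^{2N+2} dU = (N+1)! − 1` — the first deviation of the strong-coupling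
expansion of the 2-d `U(N)` one-plaquette law from the Gaussian `e^{x²/4}`, at order `x^{2N+2}`.

* `parts_eq_replicate_of_card_eq`: a partition of `n` with `n` parts is `(1, …, 1)`;
* `numStandardTableaux_eq_one_of_parts_eq_replicate`: `f^{(1,…,1)} = 1` — the hook length formula (the tree's
  `numStandardTableaux_mul_prod_hookLength_holds`, Frame–Robinson–Thrall) for the column, whose hooks are
  `n, n−1, …, 1` (Mathlib's `YoungDiagram.ofRowLens`);
* `sum_filter_sq_numStandardTableaux_succ`: **`Σ_{μ ⊢ N+1, ℓ(μ) ≤ N} (f^μ)² = (N+1)! − 1`** (with the tree's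
  `sum_sq_numStandardTableaux`);
* §3 THE COLUMN ALTERNANT PAIRING `sum_coeff_mul_coeff_alternant_rho_add_one`:
  **`Σ_d [x^d](a_ρ p_1^N) · [x^d] a_{ρ+1} = N!`** (`[x^{ρ+1}](a_ρ p_1^N) = f^{(1,…,1)} = 1`, antisymmetry, and the
  monomials `sign(τ) x^{(ρ+1)∘τ⁻¹}` of `a_{ρ+1}`, the tree's `coeff_alternant_X`) — on the Weyl torus this is
  `N! · ∫_{U(N)} conj(det U) (tr U)^N dU`, the baryon vertex of `SU(N)` (sequel `SUNBaryonVertex`);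
* `choose_two_mul_div_mul_factorial`: `C(2m,m) m!/4^m = (2m)!/(4^m m!)` (arithmetic of the Gaussian moments).

No `def`, no named fact, 0 sorry.
-/

noncomputable section

open Finset MvPolynomial Equiv
open Literature.NumberTheory.DiophantineGeometry (numStandardTableaux hookLength
  numStandardTableaux_mul_prod_hookLength_holds prod_range_self_sub_eq_factorial)
open Literature.RepresentationTheory.FiniteGroups (sum_sq_numStandardTableaux coeff_alternant_X
  rename_prod_psum_mul_alternant_mul_pow coeff_alternant_mul_psum_one_pow)
open Literature.RingTheory.SymmetricFunctions.SymmPoly (alternant rho)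

namespace Summit.Ventures.LatticeQCDFlow.Scoring

/-- A partition of `n` with `n` parts is `(1, 1, …, 1)`. -/
theorem parts_eq_replicate_of_card_eq {n : ℕ} (μ : Nat.Partition n) (h : μ.parts.card = n) :
    μ.parts = Multiset.replicate n 1 := by
  rw [Multiset.eq_replicate]
  refine ⟨h, fun b hb => ?_⟩
  by_contra hb1
  have hb2 : 2 ≤ b := by have := μ.parts_pos hb; omega
  obtain ⟨t, ht⟩ := Multiset.exists_cons_of_mem hb
  have hsum := μ.parts_sum
  rw [ht, Multiset.sum_cons] at hsum
  have hcard : t.card + 1 = n := by rw [← h, ht, Multiset.card_cons]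
  have ht1 : t.card • 1 ≤ t.sum :=
    Multiset.card_nsmul_le_sum fun x hx => μ.parts_pos (by rw [ht]; exact Multiset.mem_cons_of_mem hx)
  rw [smul_eq_mul, mul_one] at ht1
  omega

/-- The sorted parts of the one-column partition. -/
theorem sortedParts_eq_replicate {n : ℕ} (μ : Nat.Partition n) (h : μ.parts = Multiset.replicate n 1) :
    μ.sortedParts = List.replicate n 1 := by
  rw [Nat.Partition.sortedParts, h, ← Multiset.coe_replicate, Multiset.coe_sort]
  exact List.mergeSort_eq_self _ (List.pairwise_replicate.mpr (Or.inr le_rfl))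

/-- The Young diagram of the one-column partition of `n` is the column `{(i, 0) : i < n}`. -/
theorem youngDiagram_eq_ofRowLens_replicate {n : ℕ} (μ : Nat.Partition n) (h : μ.parts = Multiset.replicate n 1)
    (hw : (List.replicate n 1).SortedGE) :
    μ.youngDiagram = YoungDiagram.ofRowLens (List.replicate n 1) hw := by
  have key : ∀ (l₁ l₂ : List ℕ) (h₁ : l₁.SortedGE) (h₂ : l₂.SortedGE), l₁ = l₂ →
      YoungDiagram.ofRowLens l₁ h₁ = YoungDiagram.ofRowLens l₂ h₂ := by
    rintro l₁ l₂ h₁ h₂ rfl; rfl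
  exact key _ _ _ _ (sortedParts_eq_replicate μ h)

/-- The cells of the column of height `n`. -/
theorem cells_ofRowLens_replicate (n : ℕ) (hw : (List.replicate n 1).SortedGE) :
    (YoungDiagram.ofRowLens (List.replicate n 1) hw).cells
      = (Finset.range n).map ⟨fun i => (i, 0), fun _ _ hij => (Prod.mk.inj hij).1⟩ := by
  ext ⟨i, j⟩
  rw [YoungDiagram.mem_cells, YoungDiagram.mem_ofRowLens, Finset.mem_map]
  simp only [List.length_replicate, List.getElem_replicate, Nat.lt_one_iff, Finset.mem_range,
    Function.Embedding.coeFn_mk, Prod.mk.injEq]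
  constructor
  · rintro ⟨hi, rfl⟩; exact ⟨i, hi, rfl, rfl⟩
  · rintro ⟨a, ha, rfl, rfl⟩; exact ⟨ha, rfl⟩

/-- The hook lengths of the column of height `n`: `h(i, 0) = n − i`. -/
theorem hookLength_ofRowLens_replicate {n i : ℕ} (hw : (List.replicate n 1).SortedGE) (hi : i < n) :
    hookLength (YoungDiagram.ofRowLens (List.replicate n 1) hw) (i, 0) = n - i := by
  rw [hookLength]
  have hrow : (YoungDiagram.ofRowLens (List.replicate n 1) hw).rowLen i = 1 := by
    have h := YoungDiagram.rowLen_ofRowLens (w := List.replicate n 1) (hw := hw) ⟨i, by simpa using hi⟩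
    simp only [Fin.getElem_fin, List.getElem_replicate] at h
    exact h
  have hcol : (YoungDiagram.ofRowLens (List.replicate n 1) hw).colLen 0 = n := by
    rw [← YoungDiagram.length_rowLens, YoungDiagram.rowLens_ofRowLens_eq_self (fun x hx => by
      rw [List.eq_of_mem_replicate hx]; exact one_pos), List.length_replicate]
  rw [hrow, hcol]
  omega

/-- **The one-column shape has exactly one standard Young tableau**: `f^{(1,…,1)} = 1` (hook length formula:
the hooks of the column of height `n` are `n, n − 1, …, 1`). -/
theorem numStandardTableaux_eq_one_of_parts_eq_replicate {n : ℕ} (μ : Nat.Partition n)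
    (h : μ.parts = Multiset.replicate n 1) : numStandardTableaux μ = 1 := by
  have hw : (List.replicate n 1).SortedGE := sortedParts_eq_replicate μ h ▸ μ.sortedGE_sortedParts
  have hhook := numStandardTableaux_mul_prod_hookLength_holds μ
  rw [youngDiagram_eq_ofRowLens_replicate μ h hw, cells_ofRowLens_replicate, Finset.prod_map] at hhook
  have hprod : ∏ i ∈ Finset.range n, hookLength (YoungDiagram.ofRowLens (List.replicate n 1) hw) (i, 0)
      = n.factorial := by
    rw [← prod_range_self_sub_eq_factorial]
    exact Finset.prod_congr rfl fun i hi => hookLength_ofRowLens_replicate hw (Finset.mem_range.mp hi)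
  simp only [Function.Embedding.coeFn_mk] at hhook
  rw [hprod] at hhook
  have hn : 0 < n.factorial := Nat.factorial_pos n
  nlinarith [hhook, hn]

/-- **`Σ_{μ ⊢ N+1, ℓ(μ) ≤ N} (f^μ)² = (N+1)! − 1`**: among the partitions of `N + 1` only the one-column shape has
more than `N` parts, and it carries one standard tableau. -/
theorem sum_filter_sq_numStandardTableaux_succ (N : ℕ) :
    ∑ μ ∈ univ.filter (fun μ : Nat.Partition (N + 1) => μ.parts.card ≤ N), numStandardTableaux μ ^ 2
      = (N + 1).factorial - 1 := by
  have htot := sum_sq_numStandardTableaux (N + 1)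
  rw [← Finset.sum_filter_add_sum_filter_not univ (fun μ : Nat.Partition (N + 1) => μ.parts.card ≤ N)] at htot
  have hone : ∑ μ ∈ univ.filter (fun μ : Nat.Partition (N + 1) => ¬ μ.parts.card ≤ N), numStandardTableaux μ ^ 2 = 1 := by
    have hcol : univ.filter (fun μ : Nat.Partition (N + 1) => ¬ μ.parts.card ≤ N)
        = {Nat.Partition.ofSums (N + 1) (Multiset.replicate (N + 1) 1)
          (by rw [Multiset.sum_replicate, smul_eq_mul, mul_one])} := by
      refine Finset.eq_singleton_iff_unique_mem.mpr ⟨?_, fun μ hμ => ?_⟩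
      · rw [Finset.mem_filter]
        refine ⟨Finset.mem_univ _, ?_⟩
        rw [Nat.Partition.ofSums_parts, Multiset.filter_eq_self.mpr (fun a ha => by
          rw [Multiset.eq_of_mem_replicate ha]; exact one_ne_zero), Multiset.card_replicate]
        omega
      · rw [Finset.mem_filter] at hμ
        have hle : μ.parts.card ≤ N + 1 := by
          have hμ := Multiset.card_nsmul_le_sum (s := μ.parts) (a := 1) fun x hx => μ.parts_pos hx
          rw [smul_eq_mul, mul_one, μ.parts_sum] at hμ
          exact hμ
        have hcard : μ.parts.card = N + 1 := le_antisymm hle (by omega)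
        ext1
        rw [parts_eq_replicate_of_card_eq μ hcard, Nat.Partition.ofSums_parts,
          Multiset.filter_eq_self.mpr (fun a ha => by rw [Multiset.eq_of_mem_replicate ha]; exact one_ne_zero)]
    rw [hcol, Finset.sum_singleton, numStandardTableaux_eq_one_of_parts_eq_replicate _ (by
      rw [Nat.Partition.ofSums_parts, Multiset.filter_eq_self.mpr (fun a ha => by
        rw [Multiset.eq_of_mem_replicate ha]; exact one_ne_zero)]), one_pow]
  rw [hone] at htot
  omega

/-! ### 3. The column alternant `a_{ρ+1}` paired with `a_ρ · p_1^N`: `Σ_d [x^d](a_ρ p_1^N) · [x^d] a_{ρ+1} = N!` -/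

variable {N : ℕ}

/-- Permuting an exponent vector multiplies its coefficient in the antisymmetric `a_ρ · p_1^n` by the sign. -/
theorem coeff_mapDomain_alternant_mul_psum_pow (n : ℕ) (d : Fin N →₀ ℕ) (g : Perm (Fin N)) :
    coeff (Finsupp.mapDomain g d) (alternant (fun i => (X i : MvPolynomial (Fin N) ℤ)) (rho N) *
        psum (Fin N) ℤ 1 ^ n)
      = (Equiv.Perm.sign g : ℤ) * coeff d (alternant (fun i => (X i : MvPolynomial (Fin N) ℤ)) (rho N) *
          psum (Fin N) ℤ 1 ^ n) := by
  have h := coeff_rename_mapDomain g g.injective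
    (alternant (fun i => (X i : MvPolynomial (Fin N) ℤ)) (rho N) * psum (Fin N) ℤ 1 ^ n) d
  have hG := rename_prod_psum_mul_alternant_mul_pow [] n g
  simp only [List.map_nil, List.prod_nil, one_mul] at hG
  have hC : ((Equiv.Perm.sign g : ℤ) : MvPolynomial (Fin N) ℤ) = C (Equiv.Perm.sign g : ℤ) := by simp
  rw [hG, hC, coeff_C_mul] at h
  have hs : ((Equiv.Perm.sign g : ℤ)) * (Equiv.Perm.sign g : ℤ) = 1 := by
    rw [← Units.val_mul, Int.units_mul_self, Units.val_one]
  rw [← h, ← mul_assoc, hs, one_mul]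

/-- The sorted parts of the one-column partition of `N`, padded to length `N`, are the constant vector `1`. -/
theorem getD_sortedParts_eq_one (μ : Nat.Partition N) (h : μ.parts = Multiset.replicate N 1) (i : Fin N) :
    μ.sortedParts.getD i 0 = 1 := by
  rw [sortedParts_eq_replicate μ h, List.getD_eq_getElem _ _ (by simp), List.getElem_replicate]

/-- **`[x^{ρ+1}] (a_ρ · p_1^N) = 1`**: the column shape `(1, …, 1) ⊢ N` has one standard tableau (Frobenius's
formula at the identity, the tree's `coeff_alternant_mul_psum_one_pow`, and §2). -/
theorem coeff_rho_add_one_alternant_mul_psum_pow (N : ℕ) :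
    coeff (Finsupp.equivFunOnFinite.symm fun j => rho N j + 1)
        (alternant (fun i => (X i : MvPolynomial (Fin N) ℤ)) (rho N) * psum (Fin N) ℤ 1 ^ N) = 1 := by
  set μ : Nat.Partition N := Nat.Partition.ofSums N (Multiset.replicate N 1)
    (by rw [Multiset.sum_replicate, smul_eq_mul, mul_one]) with hμ
  have hparts : μ.parts = Multiset.replicate N 1 := by
    rw [hμ, Nat.Partition.ofSums_parts, Multiset.filter_eq_self.mpr (fun a ha => by
      rw [Multiset.eq_of_mem_replicate ha]; exact one_ne_zero)]
  have hcard : μ.parts.card ≤ N := by rw [hparts, Multiset.card_replicate]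
  have h := coeff_alternant_mul_psum_one_pow μ hcard
  rw [numStandardTableaux_eq_one_of_parts_eq_replicate μ hparts, Nat.cast_one] at h
  rw [← h]
  congr 2
  funext j
  rw [Pi.add_apply, getD_sortedParts_eq_one μ hparts, add_comm]

/-- **`Σ_d [x^d](a_ρ p_1^N) · [x^d] a_{ρ+1} = N!`**: the coefficient pairing of `a_ρ · p_1^N` with the column
alternant `a_{ρ+1} = Σ_τ sign(τ) x^{(ρ+1)∘τ⁻¹}` picks `N!` signed copies of `[x^{ρ+1}](a_ρ p_1^N) = 1` (by the
antisymmetry of `a_ρ p_1^N` the signs cancel).  On the Weyl torus this is `N! ∫_{U(N)} conj(det U) (tr U)^N dU`. -/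
theorem sum_coeff_mul_coeff_alternant_rho_add_one (N : ℕ) :
    ∑ d ∈ (alternant (fun i => (X i : MvPolynomial (Fin N) ℤ)) (rho N) * psum (Fin N) ℤ 1 ^ N).support,
        coeff d (alternant (fun i => (X i : MvPolynomial (Fin N) ℤ)) (rho N) * psum (Fin N) ℤ 1 ^ N) *
          coeff d (alternant (fun i => (X i : MvPolynomial (Fin N) ℤ)) fun j => rho N j + 1)
      = N.factorial := by
  set G := alternant (fun i => (X i : MvPolynomial (Fin N) ℤ)) (rho N) * psum (Fin N) ℤ 1 ^ N with hG
  simp_rw [coeff_alternant_X (fun j => rho N j + 1), Finset.mul_sum, mul_ite, mul_zero]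
  rw [Finset.sum_comm]
  have h1 : ∀ τ : Perm (Fin N), ∑ d ∈ G.support,
      (if (Finsupp.equivFunOnFinite.symm fun j => rho N (τ⁻¹ j) + 1) = d then coeff d G * (Equiv.Perm.sign τ : ℤ)
        else 0)
      = coeff (Finsupp.equivFunOnFinite.symm fun j => rho N (τ⁻¹ j) + 1) G * (Equiv.Perm.sign τ : ℤ) := by
    intro τ
    rw [Finset.sum_ite_eq]
    split_ifs with h
    · rfl
    · rw [MvPolynomial.notMem_support_iff.mp h, zero_mul]
  simp_rw [h1]
  have h2 : ∀ τ : Perm (Fin N), (Finsupp.equivFunOnFinite.symm fun j => rho N (τ⁻¹ j) + 1)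
      = Finsupp.mapDomain (τ : Perm (Fin N)) (Finsupp.equivFunOnFinite.symm fun j => rho N j + 1) := by
    intro τ; ext a
    simp [Finsupp.mapDomain_equiv_apply, Equiv.Perm.inv_def]
  have hs : ∀ τ : Perm (Fin N), ((Equiv.Perm.sign τ : ℤ)) * (Equiv.Perm.sign τ : ℤ) = 1 := fun τ => by
    rw [← Units.val_mul, Int.units_mul_self, Units.val_one]
  have h3 : ∀ τ : Perm (Fin N), coeff (Finsupp.equivFunOnFinite.symm fun j => rho N (τ⁻¹ j) + 1) G *
      (Equiv.Perm.sign τ : ℤ) = 1 := by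
    intro τ
    rw [h2, hG, coeff_mapDomain_alternant_mul_psum_pow, coeff_rho_add_one_alternant_mul_psum_pow, mul_one, hs]
  simp_rw [h3]
  rw [Finset.sum_const, Finset.card_univ, Fintype.card_perm, Fintype.card_fin, nsmul_eq_mul, mul_one]

/-- `C(2m, m) · m! / 4^m = (2m)!/(4^m m!)` (the even Gaussian moments `(2m)!/(4^m m!)` of variance `½` from the
central binomial coefficients). -/
theorem choose_two_mul_div_mul_factorial (m : ℕ) :
    ((2 * m).choose m : ℝ) / 4 ^ m * m.factorial = ((2 * m).factorial : ℝ) / (4 ^ m * m.factorial) := by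
  have h := Nat.choose_mul_factorial_mul_factorial (show m ≤ 2 * m by omega)
  rw [show 2 * m - m = m by omega] at h
  have h' : ((2 * m).choose m : ℝ) * m.factorial * m.factorial = (2 * m).factorial := by exact_mod_cast h
  have hm : (m.factorial : ℝ) ≠ 0 := by positivity
  field_simp
  rw [← h']
  ring

end Summit.Ventures.LatticeQCDFlow.Scoring
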